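import Literature.Probability.RandomPlanarGeometry.SchrammLeftPassage
import Literature.Probability.RandomPlanarGeometry.SchrammSlopeReturn
import Literature.Probability.RandomPlanarGeometry.SchrammSlopeConfinement
import HarnessLib

/-!
# Proof of Schramm's slope dichotomy: a.s. `w_t → +∞` or `w_t → -∞` as `t ↑ τ(z₀)` (`0 < κ < 8`)

Topic `Probability/RandomPlanarGeometry`; theorems only. This file discharges the named fact
`Literature.Probability.RandomPlanarGeometry.Schramm2001_slope_dichotomy` (`SchrammLeftPassage.lean`;
the sibling `SchrammLeftPassageProofs.lean` discharges the `κ = 8/3` formula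
`Schramm2001_passesLeft_eightThirds` and proves the `κ = 8/3` dichotomy by martingale convergence;
the present file treats all `κ ∈ (0, 8)` by the quantitative return estimate of
`SchrammSlopeReturn.lean`):
O. Schramm, *A percolation formula*, Electron. Comm. Probab. **6** (2001), proof of Thm. 2 with
Lemma 3 — for the slope `w_t = x_t/y_t` of `x_t + i y_t = g_t(z₀) - W(t)` under chordal SLE_κ,
`0 < κ < 8`, "the diffusion process `dw = -dW̃ + 4w du/(w² + 1)` is transient", i.e. almost surely
`w_t → +∞` (`Loewner.PassesLeft`) or `w_t → -∞` (`Loewner.PassesRight`) as `t ↑ τ(z₀)`.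

The printed proof appeals to the scale-function criterion for one-dimensional diffusions (the
scale function `f(w) = w ₂F₁(½, 4/κ; 3/2; -w²) = ∫₀ʷ (1+v²)^{-4/κ} dv` is bounded iff `κ < 8`;
Revuz–Yor (1999), Ch. VII §3). Its two halves were proved in the original time parameter in

* `SchrammSlopeConfinement.lean` — a.s. the slope leaves every bounded interval at arbitrarily late
  times before `τ(z₀)` (`ae_frequently_lt_abs_cotArg`; Schramm's clock `u = ∫ dt/y² → ∞` and
  `Z(z₀) < ∞` a.s. for `κ < 8`);
* `SchrammSlopeReturn.lean` — after `|w|` first reaches `L₂`, a return to `|w| ≤ L` before the cap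
  `T_{L₃} ∧ ρₙ` has probability `≤ 2 (f(∞) - f(L₂))/(f(∞) - f(L))` (`measureReal_sleSlopeReturnEvent_le`,
  optional stopping of Schramm's martingale `f(w_{t∧C})`).

Here: (i) the return events `Aₙ` (with `L₃ = L₂ + 1 + n`) increase in `n` and cover the pathwise
event "`|w|` returns to `≤ L` after its first exit from `(-L₂, L₂)`", so the latter has probability
`≤ 2 (f(∞) - f(L₂))/(f(∞) - f(L))` (`measure_sleSlopeReturn_le`); (ii) the event "`|w_t| ≤ L` cofinally as
`t ↑ τ(z₀)`" is contained in it up to the null event of eventual confinement in `(-L₂, L₂)`, for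
every `L₂`, and `f(L₂) → f(∞)` (`measure_cofinally_abs_cotArg_le_eq_zero`); (iii) pathwise, a
continuous slope with `|w_t| → ∞` keeps a constant sign near `τ(z₀)` (intermediate value theorem),
hence tends to `+∞` or to `-∞` (`Loewner.passesLeft_or_passesRight_of_forall_eventually_lt_abs`);
(iv) `Schramm2001_slope_dichotomy_holds`.

## References

* O. Schramm, *A percolation formula*, Electron. Comm. Probab. 6 (2001) 115–120
  (arXiv:math/0107096), Thm. 2 (proof) and Lemma 3.
* D. Revuz, M. Yor, *Continuous Martingales and Brownian Motion* (1999), Ch. VII §3.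
-/

noncomputable section

open Set Filter MeasureTheory Complex
open _root_.Topology
open scoped NNReal ENNReal

namespace Literature.Probability.RandomPlanarGeometry

open Loewner Literature.Probability.Process

/-! ### Pathwise: a continuous slope with `|w_t| → ∞` has a limit `±∞` -/

namespace Loewner

variable {W : ℝ≥0 → ℝ} {z : ℂ}

/-- On an interval `[t₀, t] ⊆ [0, τ(z))` on which the slope does not vanish, it keeps the sign of
`w_{t₀}` (intermediate value theorem for the continuous slope). [folklore] -/
theorem cotArg_pos_of_forall_ne_zero (hW : Continuous W) (hz : 0 < z.im) {t₀ t : ℝ≥0} (h0t : t₀ ≤ t)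
    (ht : (t : WithTop ℝ≥0) < swallowingTime W z) (hne : ∀ s : ℝ≥0, t₀ ≤ s → s ≤ t → cotArg W z s ≠ 0)
    (hpos : 0 < cotArg W z t₀) : 0 < cotArg W z t := by
  by_contra hle
  push Not at hle
  have hcont : ContinuousOn (cotArg W z) (Icc t₀ t) :=
    (continuousOn_cotArg hW hz).mono fun s hs ↦ lt_of_le_of_lt (WithTop.coe_le_coe.2 hs.2) ht
  have hmem : (0 : ℝ) ∈ Icc (cotArg W z t) (cotArg W z t₀) := ⟨hle, hpos.le⟩
  obtain ⟨c, hc, hc0⟩ := intermediate_value_Icc' h0t hcont hmem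
  exact hne c hc.1 hc.2 hc0

/-- **If `|w_t| → ∞` as `t ↑ τ(z)` then `w_t → +∞` or `w_t → -∞`**: for a continuous driving
function and `z ∈ ℍ`, if for every `L : ℕ` the slope satisfies `|w_t| > L` for all `t < τ(z)` late
enough, then the chain passes to the left or to the right of `z` in Schramm's sense (the slope is
continuous on `[0, τ(z))` and eventually non-zero, hence eventually of constant sign). [folklore] -/
theorem passesLeft_or_passesRight_of_forall_eventually_lt_abs (hW : Continuous W) (hz : 0 < z.im)
    (h : ∀ L : ℕ, ∃ t₀ : ℝ≥0, (t₀ : WithTop ℝ≥0) < swallowingTime W z ∧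
      ∀ t : ℝ≥0, t₀ ≤ t → (t : WithTop ℝ≥0) < swallowingTime W z → (L : ℝ) < |cotArg W z t|) :
    PassesLeft W z ∨ PassesRight W z := by
  obtain ⟨t₀, ht₀, h0⟩ := h 0
  haveI : Nonempty {t : ℝ≥0 // (t : WithTop ℝ≥0) < swallowingTime W z} := ⟨⟨t₀, ht₀⟩⟩
  have hne : ∀ s : ℝ≥0, t₀ ≤ s → (s : WithTop ℝ≥0) < swallowingTime W z → cotArg W z s ≠ 0 := by
    intro s hs hsT h0'
    have := h0 s hs hsT
    rw [h0', abs_zero] at this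
    exact lt_irrefl _ (by exact_mod_cast this)
  -- the level sets: for `L`, a time after which `|w| > L`, taken `≥ t₀`
  have hlev : ∀ L : ℕ, ∃ t₁ : {t : ℝ≥0 // (t : WithTop ℝ≥0) < swallowingTime W z}, t₀ ≤ t₁ ∧
      ∀ t : {t : ℝ≥0 // (t : WithTop ℝ≥0) < swallowingTime W z}, t₁ ≤ t → (L : ℝ) < |cotArg W z t| := by
    intro L
    obtain ⟨t₁, ht₁, h1⟩ := h L
    refine ⟨⟨max t₀ t₁, ?_⟩, le_max_left _ _, fun t ht ↦ h1 t ((le_max_right _ _).trans ht) t.2⟩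
    rcases le_total t₀ t₁ with h' | h'
    · rw [max_eq_right h']; exact ht₁
    · rw [max_eq_left h']; exact ht₀
  rcases lt_or_gt_of_ne (hne t₀ le_rfl ht₀) with hneg | hpos
  · -- `w_{t₀} < 0`: the slope stays negative and tends to `-∞`
    right
    rw [PassesRight, tendsto_atTop_atBot]
    intro b
    obtain ⟨t₁, ht₁, h1⟩ := hlev ⌈-b⌉₊
    refine ⟨t₁, fun t ht ↦ ?_⟩
    have h0t : t₀ ≤ (t : ℝ≥0) := ht₁.trans ht
    have hsign : cotArg W z t < 0 := by
      -- apply the positive version to `-w`? directly: by contradiction with the IVT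
      by_contra hge
      push Not at hge
      have hpos' : 0 < cotArg W z t := lt_of_le_of_ne hge (hne t h0t t.2).symm
      have hcont : ContinuousOn (cotArg W z) (Icc t₀ t) :=
        (continuousOn_cotArg hW hz).mono fun s hs ↦ lt_of_le_of_lt (WithTop.coe_le_coe.2 hs.2) t.2
      have hmem : (0 : ℝ) ∈ Icc (cotArg W z t₀) (cotArg W z t) := ⟨hneg.le, hpos'.le⟩
      obtain ⟨c, hc, hc0⟩ := intermediate_value_Icc h0t hcont hmem
      exact hne c hc.1 (lt_of_le_of_lt (WithTop.coe_le_coe.2 hc.2) t.2) hc0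
    have habs := h1 t ht
    rw [abs_of_neg hsign] at habs
    have hb : -b ≤ (⌈-b⌉₊ : ℝ) := Nat.le_ceil _
    linarith
  · -- `w_{t₀} > 0`: the slope stays positive and tends to `+∞`
    left
    rw [PassesLeft, tendsto_atTop_atTop]
    intro b
    obtain ⟨t₁, ht₁, h1⟩ := hlev ⌈b⌉₊
    refine ⟨t₁, fun t ht ↦ ?_⟩
    have h0t : t₀ ≤ (t : ℝ≥0) := ht₁.trans ht
    have hsign : 0 < cotArg W z t :=
      cotArg_pos_of_forall_ne_zero hW hz h0t t.2
        (fun s hs hst ↦ hne s hs (lt_of_le_of_lt (WithTop.coe_le_coe.2 hst) t.2)) hpos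
    have habs := h1 t ht
    rw [abs_of_pos hsign] at habs
    have hb : b ≤ (⌈b⌉₊ : ℝ) := Nat.le_ceil _
    linarith

end Loewner

/-! ### The return events increase and cover the pathwise return event -/

variable {κ : ℝ≥0} {z : ℂ} {L L₂ : ℝ}

/-- The gauges `|x^{ρₙ}| - L y^{ρₙ}` and `|x^{ρₘ}| - L y^{ρₘ}` agree up to `ρₙ`, `n ≤ m`. [folklore] -/
theorem sleSlopeGauge_eq_of_le (hz : 0 < z.im) {n m : ℕ} (hnm : n ≤ m) {t : ℝ≥0} {ω : ℝ≥0 → ℝ}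
    (ht : (t : WithTop ℝ≥0) ≤ slePointLocTime κ z n ω) :
    sleSlopeGauge κ z L m t ω = sleSlopeGauge κ z L n t ω := by
  have htm : (t : WithTop ℝ≥0) ≤ slePointLocTime κ z m ω := ht.trans (slePointLocTime_mono hz ω hnm)
  simp only [sleSlopeGauge, stoppedProcess_eq_of_le ht, stoppedProcess_eq_of_le htm]

/-- **The return events increase in `n`** (levels `L₃ = L₂ + 1 + n`): on `Aₙ` the level `L₂` is
reached at `T_{L₂} < ρₙ ≤ ρₘ`, so `τₘ = τₙ`; the caps increase; and the return time of index `m`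
is at most that of index `n` (same gauge up to `ρₙ`). [folklore] -/
theorem sleSlopeReturnEvent_mono (hz : 0 < z.im) (L L₂ : ℝ) :
    Monotone fun n : ℕ ↦ sleSlopeReturnEvent κ z L L₂ (L₂ + 1 + n) n := by
  refine monotone_nat_of_le_succ fun n ↦ ?_
  intro ω hω
  obtain ⟨hτC, hυC⟩ := hω
  have hnm : n ≤ n + 1 := n.le_succ
  have hρ : slePointLocTime κ z n ω ≤ slePointLocTime κ z (n + 1) ω := slePointLocTime_mono hz ω hnm
  have hCρ : sleCotArgLocTime κ z (L₂ + 1 + n) n ω ≤ slePointLocTime κ z n ω :=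
    sleCotArgLocTime_le_locTime _ n ω
  -- the caps increase
  have hCC : sleCotArgLocTime κ z (L₂ + 1 + n) n ω ≤ sleCotArgLocTime κ z (L₂ + 1 + (n + 1 : ℕ)) (n + 1) ω := by
    refine min_le_min (cotArgExitTime_mono _ _ (by push_cast; linarith)) hρ
  -- `τₙ₊₁ = τₙ`
  have hτρ : sleCotArgLocTime κ z L₂ n ω < slePointLocTime κ z n ω := hτC.trans_le hCρ
  have hT : cotArgExitTime (sleDriving κ ω) z L₂ = sleCotArgLocTime κ z L₂ n ω :=
    cotArgExitTime_eq_of_sleCotArgLocTime_lt hτρ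
  have hττ : sleCotArgLocTime κ z L₂ (n + 1) ω = sleCotArgLocTime κ z L₂ n ω := by
    change min (cotArgExitTime (sleDriving κ ω) z L₂) (slePointLocTime κ z (n + 1) ω) = _
    rw [hT]
    exact min_eq_left (hτρ.le.trans hρ)
  refine ⟨?_, ?_⟩
  · rw [hττ]; exact hτC.trans_le hCC
  · -- the return time of index `n + 1` is at most that of index `n`
    have hne : sleSlopeReturnTime κ z L L₂ n ω ≠ ⊤ :=
      ne_top_of_le_ne_top (sleCotArgLocTime_ne_top _ n ω) hυC
    obtain ⟨u, hu⟩ := WithTop.ne_top_iff_exists.1 hne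
    have hu' : sleSlopeReturnTime κ z L L₂ n ω = u := hu.symm
    have huC : (u : WithTop ℝ≥0) ≤ sleCotArgLocTime κ z (L₂ + 1 + n) n ω := hu ▸ hυC
    have huρ : (u : WithTop ℝ≥0) ≤ slePointLocTime κ z n ω := huC.trans hCρ
    have hmem : sleSlopeGauge κ z L n u ω ∈ Iic (0 : ℝ) :=
      mem_of_hittingFrom_eq_coe isClosed_Iic (continuous_sleSlopeGauge hz L n ω) hu'
    have hmem' : sleSlopeGauge κ z L (n + 1) u ω ∈ Iic (0 : ℝ) := by
      rwa [sleSlopeGauge_eq_of_le hz hnm huρ]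
    have hτu : sleCotArgLocTime κ z L₂ (n + 1) ω ≤ u := by
      rw [hττ, ← hu']; exact sleCotArgLocTime_le_returnTime ω
    calc sleSlopeReturnTime κ z L L₂ (n + 1) ω ≤ u := hittingFrom_le_of_mem hτu hmem'
      _ ≤ sleCotArgLocTime κ z (L₂ + 1 + n) n ω := huC
      _ ≤ _ := hCC

/-- A time `t < τ(z)` is strictly before `ρₙ` for all large `n` (there is a later time `< τ(z)`,
itself eventually `≤ ρₙ`). [folklore] -/
theorem exists_coe_lt_slePointLocTime (hz : 0 < z.im) (ω : ℝ≥0 → ℝ) {t : ℝ≥0}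
    (ht : (t : WithTop ℝ≥0) < swallowingTime (sleDriving κ ω) z) :
    ∃ N : ℕ, ∀ n, N ≤ n → (t : WithTop ℝ≥0) < slePointLocTime κ z n ω := by
  obtain ⟨c, htc, hcT⟩ := exists_between ht
  have hc : c ≠ ⊤ := ne_top_of_lt hcT
  obtain ⟨t', ht'⟩ := WithTop.ne_top_iff_exists.1 hc
  rw [← ht'] at htc hcT
  obtain ⟨N, hN⟩ := exists_le_slePointLocTime hz ω hcT
  exact ⟨N, fun n hn ↦ htc.trans_le (hN n hn)⟩

/-- **The pathwise return event is covered by the `Aₙ`**: if `|w|` first reaches `L₂` at the finite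
time `u = T_{L₂}` and `|w_t| ≤ L` at some later `t < τ(z)`, then `ω ∈ Aₙ` for a suitable `n`
(`ρₙ > t` and `L₂ + 1 + n > sup_{[0,t]} |w|`, so that neither the cap `T_{L₂+1+n}` nor `ρₙ` rings by
time `t`). [folklore] -/
theorem mem_iUnion_sleSlopeReturnEvent (hz : 0 < z.im) {ω : ℝ≥0 → ℝ} {u t : ℝ≥0}
    (hu : cotArgExitTime (sleDriving κ ω) z L₂ = u) (hut : u ≤ t)
    (ht : (t : WithTop ℝ≥0) < swallowingTime (sleDriving κ ω) z)
    (hL : |cotArg (sleDriving κ ω) z t| ≤ L) :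
    ω ∈ ⋃ n : ℕ, sleSlopeReturnEvent κ z L L₂ (L₂ + 1 + n) n := by
  have hW := continuous_sleDriving κ ω
  -- a bound for `|w|` on `[0, t]`
  obtain ⟨S, hS⟩ : ∃ S, ∀ s ∈ Icc (0 : ℝ≥0) t, |cotArg (sleDriving κ ω) z s| ≤ S := by
    have hc : ContinuousOn (fun s ↦ |cotArg (sleDriving κ ω) z s|) (Icc 0 t) :=
      (continuousOn_abs_cotArg hW hz).mono fun s hs ↦ lt_of_le_of_lt (WithTop.coe_le_coe.2 hs.2) ht
    obtain ⟨S, hS⟩ := isCompact_Icc.exists_bound_of_continuousOn hc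
    exact ⟨S, fun s hs ↦ by simpa [Real.norm_eq_abs] using hS s hs⟩
  obtain ⟨N₁, hN₁⟩ := exists_coe_lt_slePointLocTime hz ω ht
  obtain ⟨N₂, hN₂⟩ := exists_nat_gt (S - L₂ - 1)
  set n : ℕ := max N₁ N₂ with hn
  have hρ : (t : WithTop ℝ≥0) < slePointLocTime κ z n ω := hN₁ n (le_max_left _ _)
  have hSn : S < L₂ + 1 + n := by
    have : (N₂ : ℝ) ≤ n := by exact_mod_cast le_max_right N₁ N₂
    linarith
  -- the cap level is not reached by time `t`
  have hcap : (t : WithTop ℝ≥0) < cotArgExitTime (sleDriving κ ω) z (L₂ + 1 + n) := by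
    by_contra hle
    push Not at hle
    have hne : cotArgExitTime (sleDriving κ ω) z (L₂ + 1 + n) ≠ ⊤ := ne_top_of_le_ne_top WithTop.coe_ne_top hle
    obtain ⟨t₂, ht₂, hlt₂, hs₂⟩ := exists_cotArgExitTime_eq_coe hW hz hne
    have ht₂t : t₂ ≤ t := by rw [ht₂] at hle; exact WithTop.coe_le_coe.1 hle
    have := hS t₂ ⟨zero_le, ht₂t⟩
    linarith
  have hC : (t : WithTop ℝ≥0) < sleCotArgLocTime κ z (L₂ + 1 + n) n ω := lt_min hcap hρ
  -- `τₙ = u ≤ t`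
  have hτ : sleCotArgLocTime κ z L₂ n ω = u := by
    change min (cotArgExitTime (sleDriving κ ω) z L₂) (slePointLocTime κ z n ω) = u
    rw [hu]
    exact min_eq_left ((WithTop.coe_le_coe.2 hut).trans hρ.le)
  refine mem_iUnion.2 ⟨n, ?_, ?_⟩
  · rw [hτ]; exact (WithTop.coe_le_coe.2 hut).trans_lt hC
  · have hmem : sleSlopeGauge κ z L n t ω ∈ Iic (0 : ℝ) := (sleSlopeGauge_nonpos_iff hz hρ.le).2 hL
    have hτt : sleCotArgLocTime κ z L₂ n ω ≤ t := by rw [hτ]; exact WithTop.coe_le_coe.2 hut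
    exact (hittingFrom_le_of_mem hτt hmem).trans hC.le

/-- **`P[|w| returns to ≤ L after first reaching L₂] ≤ 2 (f(∞) - f(L₂))/(f(∞) - f(L))`**
(`0 < κ < 8`, `z ∈ ℍ`, `L < L₂`, `|w₀| < L₂`): the pathwise event lies in the increasing union of the
`Aₙ`, each of probability at most the bound. [cite: Schramm2001Percolation, Thm. 2 (proof)] -/
theorem measure_sleSlopeReturn_le (hκ : 0 < κ) (hκ8 : κ < 8) (hz : 0 < z.im) (hL : L < L₂)
    (h0 : |z.re / z.im| < L₂) :
    preWienerMeasure {ω | ∃ u : ℝ≥0, cotArgExitTime (sleDriving κ ω) z L₂ = u ∧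
        ∃ t : ℝ≥0, u ≤ t ∧ (t : WithTop ℝ≥0) < swallowingTime (sleDriving κ ω) z ∧
          |cotArg (sleDriving κ ω) z t| ≤ L} ≤
      ENNReal.ofReal (2 * ((schrammScaleSup κ - schrammScale κ L₂) /
        (schrammScaleSup κ - schrammScale κ L))) := by
  haveI := isProbabilityMeasure_preWienerMeasure'
  have hsub : {ω | ∃ u : ℝ≥0, cotArgExitTime (sleDriving κ ω) z L₂ = u ∧
      ∃ t : ℝ≥0, u ≤ t ∧ (t : WithTop ℝ≥0) < swallowingTime (sleDriving κ ω) z ∧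
        |cotArg (sleDriving κ ω) z t| ≤ L} ⊆ ⋃ n : ℕ, sleSlopeReturnEvent κ z L L₂ (L₂ + 1 + n) n := by
    rintro ω ⟨u, hu, t, hut, ht, hLt⟩
    exact mem_iUnion_sleSlopeReturnEvent hz hu hut ht hLt
  refine (measure_mono hsub).trans ?_
  rw [(sleSlopeReturnEvent_mono (κ := κ) hz L L₂).measure_iUnion]
  refine iSup_le fun n ↦ ?_
  rw [← ofReal_measureReal]
  refine ENNReal.ofReal_le_ofReal ?_
  exact measureReal_sleSlopeReturnEvent_le hκ hκ8 hz hL (by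
    have : (0 : ℝ) ≤ n := n.cast_nonneg
    linarith) h0 n

/-! ### Cofinal smallness of `|w|` is a null event -/

/-- **For `0 < κ < 8`, `z ∈ ℍ` and every `L`, the event "`|w_t| ≤ L` at times arbitrarily close to
`τ(z)`" is null.** For every `L₂ > max(L, |w₀|)`: outside the null event of eventual confinement in
`(-L₂, L₂)` (`ae_frequently_lt_abs_cotArg`) the slope reaches `L₂`, at the finite exit time `T_{L₂}`,
and then returns to `|w| ≤ L`, an event of probability `≤ 2 (f(∞) - f(L₂))/(f(∞) - f(L)) → 0`
(`L₂ → ∞`, `tendsto_schrammScaleSup_sub_atTop`). [cite: Schramm2001Percolation, Thm. 2 (proof)] -/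
theorem measure_cofinally_abs_cotArg_le_eq_zero (hκ : 0 < κ) (hκ8 : κ < 8) (hz : 0 < z.im) (L : ℝ) :
    preWienerMeasure {ω | ∀ t₀ : ℝ≥0, (t₀ : WithTop ℝ≥0) < swallowingTime (sleDriving κ ω) z →
      ∃ t : ℝ≥0, t₀ ≤ t ∧ (t : WithTop ℝ≥0) < swallowingTime (sleDriving κ ω) z ∧
        |cotArg (sleDriving κ ω) z t| ≤ L} = 0 := by
  haveI := isProbabilityMeasure_preWienerMeasure'
  set F : Set (ℝ≥0 → ℝ) := {ω | ∀ t₀ : ℝ≥0, (t₀ : WithTop ℝ≥0) < swallowingTime (sleDriving κ ω) z →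
      ∃ t : ℝ≥0, t₀ ≤ t ∧ (t : WithTop ℝ≥0) < swallowingTime (sleDriving κ ω) z ∧
        |cotArg (sleDriving κ ω) z t| ≤ L} with hF
  set p : ℕ → ℝ := fun m ↦ 2 * ((schrammScaleSup κ - schrammScale κ m) /
      (schrammScaleSup κ - schrammScale κ L)) with hp
  -- `p m → 0`
  have hden : 0 < schrammScaleSup κ - schrammScale κ L := sub_pos.2 (schrammScale_lt_sup hκ hκ8 L)
  have hp0 : Tendsto p atTop (𝓝 0) := by
    have h1 := (tendsto_schrammScaleSup_sub_atTop hκ hκ8).comp tendsto_natCast_atTop_atTop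
    have h2 : Tendsto (fun m : ℕ ↦ 2 * ((schrammScaleSup κ - schrammScale κ m) /
        (schrammScaleSup κ - schrammScale κ L))) atTop (𝓝 (2 * (0 / (schrammScaleSup κ - schrammScale κ L)))) :=
      (h1.div_const _).const_mul 2
    rw [zero_div, mul_zero] at h2
    exact h2
  have hp0' : Tendsto (fun m ↦ ENNReal.ofReal (p m)) atTop (𝓝 0) := by
    rw [← ENNReal.ofReal_zero]
    exact ENNReal.tendsto_ofReal hp0
  -- `μ F ≤ p m` for every large `m`
  have hbound : ∀ᶠ m : ℕ in atTop, preWienerMeasure F ≤ ENNReal.ofReal (p m) := by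
    filter_upwards [eventually_gt_atTop ⌈max L |z.re / z.im|⌉₊] with m hm
    have hm : max L |z.re / z.im| < m := by
      have h1 : max L |z.re / z.im| ≤ (⌈max L |z.re / z.im|⌉₊ : ℝ) := Nat.le_ceil _
      have h2 : ((⌈max L |z.re / z.im|⌉₊ : ℕ) : ℝ) < m := by exact_mod_cast hm
      linarith
    have hLm : L < m := (le_max_left _ _).trans_lt hm
    have h0m : |z.re / z.im| < m := (le_max_right _ _).trans_lt hm
    -- the good event: the slope exceeds `m` cofinally
    set G : Set (ℝ≥0 → ℝ) := {ω | ∀ t₀ : ℝ≥0, (t₀ : WithTop ℝ≥0) < swallowingTime (sleDriving κ ω) z →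
        ∃ t : ℝ≥0, t₀ ≤ t ∧ (t : WithTop ℝ≥0) < swallowingTime (sleDriving κ ω) z ∧
          (m : ℝ) < |cotArg (sleDriving κ ω) z t|} with hG
    have hGc : preWienerMeasure Gᶜ = 0 := by
      have h := ae_frequently_lt_abs_cotArg hκ hκ8 hz (m : ℝ) (z := z)
      rw [ae_iff] at h
      exact h
    -- `F ∩ G ⊆ Return(L, m)`
    have hsub : F ∩ G ⊆ {ω | ∃ u : ℝ≥0, cotArgExitTime (sleDriving κ ω) z m = u ∧
        ∃ t : ℝ≥0, u ≤ t ∧ (t : WithTop ℝ≥0) < swallowingTime (sleDriving κ ω) z ∧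
          |cotArg (sleDriving κ ω) z t| ≤ L} := by
      rintro ω ⟨hωF, hωG⟩
      have hW := continuous_sleDriving κ ω
      have hT0 : ((0 : ℝ≥0) : WithTop ℝ≥0) < swallowingTime (sleDriving κ ω) z :=
        swallowingTime_pos_holds hW (ne_driving_of_im_pos hz 0)
      obtain ⟨t₁, -, ht₁, hmt₁⟩ := hωG 0 hT0
      have hne : cotArgExitTime (sleDriving κ ω) z m ≠ ⊤ :=
        ne_top_of_le_ne_top WithTop.coe_ne_top (cotArgExitTime_le _ _ ht₁ hmt₁.le)
      obtain ⟨u, hu, huT, -⟩ := exists_cotArgExitTime_eq_coe hW hz hne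
      obtain ⟨t, hut, ht, hLt⟩ := hωF u huT
      exact ⟨u, hu, t, hut, ht, hLt⟩
    calc preWienerMeasure F ≤ preWienerMeasure (F ∩ G ∪ Gᶜ) := by
          refine measure_mono fun ω hω ↦ ?_
          by_cases hωG : ω ∈ G
          · exact Or.inl ⟨hω, hωG⟩
          · exact Or.inr hωG
      _ ≤ preWienerMeasure (F ∩ G) + preWienerMeasure Gᶜ := measure_union_le _ _
      _ ≤ ENNReal.ofReal (p m) + 0 := by
          rw [hGc]
          refine add_le_add ((measure_mono hsub).trans ?_) le_rfl
          exact measure_sleSlopeReturn_le hκ hκ8 hz hLm h0m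
      _ = ENNReal.ofReal (p m) := add_zero _
  exact le_antisymm (ge_of_tendsto hp0' hbound) (zero_le)

/-! ### The dichotomy -/

/-- **Schramm's slope dichotomy (Schramm (2001), proof of Thm. 2 with Lemma 3): for `0 < κ < 8` and
`z₀ ∈ ℍ`, almost surely `w_t → +∞` or `w_t → -∞` as `t ↑ τ(z₀)`** — discharge of the named fact
`Schramm2001_slope_dichotomy`. For each `L : ℕ` the slope a.s. eventually satisfies `|w_t| > L`
(`measure_cofinally_abs_cotArg_le_eq_zero`); intersecting over `L` and using the continuity of the
slope, it tends to `+∞` or to `-∞`. [cite: Schramm2001Percolation, Thm. 2 (proof) and Lemma 3] -/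
theorem Schramm2001_slope_dichotomy_holds : Schramm2001_slope_dichotomy := by
  intro κ hκ hκ8 z hz
  have hL : ∀ L : ℕ, ∀ᵐ ω ∂preWienerMeasure, ∃ t₀ : ℝ≥0,
      (t₀ : WithTop ℝ≥0) < swallowingTime (sleDriving κ ω) z ∧
        ∀ t : ℝ≥0, t₀ ≤ t → (t : WithTop ℝ≥0) < swallowingTime (sleDriving κ ω) z →
          (L : ℝ) < |cotArg (sleDriving κ ω) z t| := by
    intro L
    rw [ae_iff]
    have h := measure_cofinally_abs_cotArg_le_eq_zero hκ hκ8 hz (L : ℝ) (z := z)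
    refine le_antisymm (le_trans (measure_mono fun ω hω ↦ ?_) h.le) (zero_le)
    intro t₀ ht₀
    simp only [mem_setOf_eq, not_exists, not_and, not_forall, not_lt] at hω
    obtain ⟨t, ht, htT, hle⟩ := hω t₀ ht₀
    exact ⟨t, ht, htT, hle⟩
  filter_upwards [ae_all_iff.2 hL] with ω hω
  exact passesLeft_or_passesRight_of_forall_eventually_lt_abs (continuous_sleDriving κ ω) hz hω

end Literature.Probability.RandomPlanarGeometry
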